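import Summits.BirchSwinnertonDyer.BirchSwinnertonDyer.Theorems.ByReductionTypeAtTwoAdditivePotGoodPrintFamily56b1
import Summits.BirchSwinnertonDyer.Rank1Residual.P2.TwistInvarianceAtTwo
import Summits.BirchSwinnertonDyer.Rank1Residual.X11b.KrausMinimalityGeneralTwo
import Summits.BirchSwinnertonDyer.Rank1Residual.X11b.CertificateCheckBridge
import Literature.NumberTheory.EllipticCurves.AdachiNomotoShii2026.TwoAdicValuationsTwistedLValues
import Literature.NumberTheory.EllipticCurves.Rank1Residual.PrintShape
import Literature.NumberTheory.EllipticCurves.Pal2012.QuadraticTwistPeriodProofs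
import HarnessLib

/-!
# K4 crux `AdditiveRankZeroAtTwo` (19098), child C3″ `AdditivePotGoodLowerHalfAtTwo` (22617) — TOOLS for the
# Adachi–Nomoto–Shii `37a1`-family (twists `37a1^{(D)}`, `D ≡ 3 (mod 4)` square-free): the global minimal model
# `V_D : y² = x³ − 16D²x + 16D³` and its habitat (additive and potentially good at `2`, non-CM, `E[2]` irreducible)

Cell `bsd-2adic`, seat `bsd-2adic-k4-w2` GEN 5 (prover, explicit unit, no kit); `--supports stmt-BirchSwinnertonDyer-22617
--as helper`. HONEST FRAMING (D-0036/D-0054): kernel lemmas about explicit Weierstrass models — NO named fact is used in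
this file; the consumer `ByReductionTypeAtTwoAdditivePotGoodPrintFamily37a1.lean` combines them with Adachi–Nomoto–Shii
2026 Thm. 4.3 (ii) BY NAME into «C3″ by print on an infinite `E[2]`-irreducible additive family». Closes nothing;
nothing booked; BSD is not proved by any of this.

CONTENTS (0 `def`, 0 `sorry`). §1 the base curve `37a1 = [0,0,1,−1,0]` (ellipticity / global minimality as
instance binders — the tree's `TamePinchR.Negative.{isElliptic,isGloballyMinimal}_thirtySevenA1`): `j = 2¹²·27/37`
(`ord₂ j = 12`, `ord₃₇ j = −1`), `E[2]` IRREDUCIBLE by the tree's Frobenius certificate at `ℓ = 3` (`#Ẽ(𝔽₃) = 7`,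
`a₃ = −3` odd; Mazur 1978 Prop. 6.3 (1)). §2 a TOOL: global minimality of an integer model from Silverman's `q¹² ∤ Δ` at
the ODD primes and Kraus's test at `2` (`isGloballyMinimal_of_int_criterion_kraus_two`, generalising the tree's
`isGloballyMinimal_of_int_criterion` to `v₂(Δ) ≥ 12`). §3 the twist: `37a1^{(D)} = [0,0,0,−D²,D³/4]` (tree model, not
`2`-integral), `V_D = C₀ • 37a1^{(D)}` with `u(C₀) = 1/2`; `Δ(V_D) = 2¹²·37·D⁶`, `c₄ = 16·48D²`, `c₆ = 64·(−216D³)`; for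
`D ≡ 3 (mod 4)` square-free, `D³ ≡ 3 (mod 4)` violates Kraus's test, so `V_D` is GLOBALLY MINIMAL
(`isGloballyMinimal_twist37`; `v₂ Δ_min(37a1^{(D)}) = 12`). (Pal's `ũ = 1/2` and the
`u = ±1` tool are in the consumer file.) §5 the habitat of C3″ at
every model `C • 37a1^{(D)}`: `Addv · 2`, `0 ≤ ord₂ j`, `¬HasCM`, `Irr · 2` (`habitat_smul_twist37`).

References: [AdachiNomotoShii2026] Acta Arith. (2026) = arXiv:2403.11474, §1 Example, §5.2; [Pal2012] Prop. 2.5, Thm.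
3.2; [Kraus1989] Prop. 2; [Mazur1978] Prop. 6.3 (1); [SilvermanAEC2009] III.1, VII.1, VII.5, VIII.8, App. C §11;
[CremonaAlgorithms1997] Table 1 (37a1).
-/

set_option autoImplicit false
set_option linter.dupNamespace false

noncomputable section

open scoped Classical

open IsDedekindDomain NumberField Rat.HeightOneSpectrum WeierstrassCurve Literature.NumberTheory.EllipticCurves
  Literature.NumberTheory.DiophantineGeometry
  Literature.NumberTheory.EllipticCurves.Rank1Residual
  Literature.NumberTheory.EllipticCurves.Rank1Residual.Typed
  Literature.NumberTheory.EllipticCurves.Rank1Residual.X11RankOneCertificates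
  Literature.NumberTheory.EllipticCurves.AdachiNomotoShii2026
  Literature.NumberTheory.EllipticCurves.ModularForms
  Literature.NumberTheory.EllipticCurves.CoatesLiTianZhai2015
  Summit.BirchSwinnertonDyer.Rank1Residual
  Summit.BirchSwinnertonDyer.Rank1Residual.X11b
  Summit.BirchSwinnertonDyer.Rank1Residual.X5.O1
  Summit.BirchSwinnertonDyer.Rank1Residual.AdditivePotMult
  Summit.BirchSwinnertonDyer.Rank1Residual.Additive
  Summit.BirchSwinnertonDyer.Rank1Residual.P2
  Summit.BirchSwinnertonDyer.BirchSwinnertonDyer.Rank1Residual.IntModel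

namespace Summit.BirchSwinnertonDyer.BirchSwinnertonDyer.Theorems.AddPotGoodPrint

/-! ## §1 The base curve `37a1 : y² + y = x³ − x` — `j` and the irreducibility of `E[2]`; ellipticity and global
minimality of `[0,0,1,−1,0]` are TAKEN AS INSTANCE BINDERS (they are the tree's
`TamePinchR.Negative.isElliptic_thirtySevenA1` / `isGloballyMinimal_thirtySevenA1`, not restated here) -/

/-- `j(37a1) = 48³/37 = 110592/37`. [cite: SilvermanAEC2009, III.1] -/
theorem j_37a1 [(⟨0, 0, 1, -1, 0⟩ : WeierstrassCurve ℚ).IsElliptic] :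
    (⟨0, 0, 1, -1, 0⟩ : WeierstrassCurve ℚ).j = 110592 / 37 := by
  have hΔ : (⟨0, 0, 1, -1, 0⟩ : WeierstrassCurve ℚ).Δ = 37 := by
    simp only [WeierstrassCurve.Δ, WeierstrassCurve.b₂, WeierstrassCurve.b₄, WeierstrassCurve.b₆, WeierstrassCurve.b₈]
    norm_num
  have hc : (⟨0, 0, 1, -1, 0⟩ : WeierstrassCurve ℚ).c₄ = 48 := by
    simp only [WeierstrassCurve.c₄, WeierstrassCurve.b₂, WeierstrassCurve.b₄]; norm_num
  rw [WeierstrassCurve.j, Units.val_inv_eq_inv_val, WeierstrassCurve.coe_Δ', hΔ, hc]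
  norm_num

/-- `ord₂ j(37a1) = ord₂(2¹²·27/37) = 12`. [folklore] -/
theorem padicValRat_two_j37 : padicValRat 2 (110592 / 37 : ℚ) = 12 := by
  haveI : Fact (Nat.Prime 2) := ⟨Nat.prime_two⟩
  have h1 : padicValRat 2 (110592 : ℚ) = 12 := by
    rw [show (110592 : ℚ) = ((2 ^ 12 * 27 : ℕ) : ℚ) by norm_num, padicValRat.of_nat,
      padicValNat.mul (by norm_num) (by norm_num), padicValNat.prime_pow,
      padicValNat.eq_zero_of_not_dvd (by norm_num : ¬ 2 ∣ 27)]
    norm_num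
  have h2 : padicValRat 2 (37 : ℚ) = 0 := by
    rw [show (37 : ℚ) = ((37 : ℕ) : ℚ) by norm_num, padicValRat.of_nat,
      padicValNat.eq_zero_of_not_dvd (by norm_num : ¬ 2 ∣ 37)]
    norm_num
  rw [padicValRat.div (by norm_num) (by norm_num), h1, h2]
  norm_num

/-- `ord₃₇ j(37a1) = −1` (so `37a1` and all its twists are non-CM). [folklore] -/
theorem padicValRat_37_j37 : padicValRat 37 (110592 / 37 : ℚ) = -1 := by
  haveI : Fact (Nat.Prime 37) := ⟨by norm_num⟩
  have h1 : padicValRat 37 (110592 : ℚ) = 0 := by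
    rw [show (110592 : ℚ) = ((110592 : ℕ) : ℚ) by norm_num, padicValRat.of_nat,
      padicValNat.eq_zero_of_not_dvd (by norm_num : ¬ 37 ∣ 110592)]
    norm_num
  have h2 : padicValRat 37 (37 : ℚ) = 1 := by exact_mod_cast padicValRat.self (p := 37) (by norm_num)
  rw [padicValRat.div (by norm_num) (by norm_num), h1, h2]
  norm_num

/-- **`37a1[2]` is IRREDUCIBLE**, by the tree's Frobenius certificate (Mazur 1978 Prop. 6.3 (1) at `p = 2`): the good
prime `ℓ = 3` has `#Ẽ(𝔽₃) = 7` (kernel point count), `a₃ = −3`, and `X² + 3X + 3` has no root mod `2`.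
[cite: Mazur1978, §6 Prop. 6.3 (1)] [cite: AdachiNomotoShii2026, §1 Example (p. 3: "a_{q_i} is odd")] -/
theorem irr_two_37a1 [(⟨0, 0, 1, -1, 0⟩ : WeierstrassCurve ℚ).IsElliptic]
    [(⟨0, 0, 1, -1, 0⟩ : WeierstrassCurve ℚ).IsGloballyMinimal] :
    (⟨0, 0, 1, -1, 0⟩ : WeierstrassCurve ℚ).HasIrreducibleModPGaloisRep 2 := by
  have hI : integralModelInt (⟨0, 0, 1, -1, 0⟩ : WeierstrassCurve ℚ) = (⟨0, 0, 1, -1, 0⟩ : WeierstrassCurve ℤ) :=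
    integralModelInt_eq_of_map_eq _ (map_mk_int 0 0 1 (-1) 0)
  have hc : Nat.card (((⟨0, 0, 1, -1, 0⟩ : WeierstrassCurve ℤ).map (Int.castRingHom (ZMod 3))).toAffine.Point) = 7 := by
    have h := natCard_point_eq_countPoints 0 0 1 (-1) 0 3 (hℓ := ⟨by norm_num⟩) (by norm_num) (by decide +kernel)
    have h' : countPoints [0, 0, 1, -1, 0] 3 = 7 := by decide +kernel
    exact_mod_cast h.trans h'
  exact hasIrreducibleModPGaloisRep_of_intModel_of_noroot (hp := ⟨Nat.prime_two⟩) (hℓ := ⟨by norm_num⟩) hI 2 3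
    (by norm_num) (by decide +kernel) hc (by decide)


/-! ## §2 A general integer-model minimality criterion: Silverman at odd primes, Kraus at `2` -/

/-- **Global minimality of an integer model from Silverman's criterion at the ODD primes and Kraus's test at `2`**
(a TOOL generalising the tree's `isGloballyMinimal_of_int_criterion` to models with `v₂(Δ) ≥ 12`): if
`c₄ = 16x`, `c₆ = 64y` with `¬((16 ∣ x ∧ (32 ∣ y ∨ 32 ∣ y − 8)) ∨ 4 ∣ y + 1)` (then the model is minimal at `2`,
`X11b.isMinimalAt_two_of_kraus_violated`, Kraus 1989 Prop. 2) and no odd prime has `q¹² ∣ Δ` (Silverman VII.1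
Rem. 1.1), the model is globally minimal. [cite: Kraus1989, Prop. 2] [cite: SilvermanAEC2009, VII.1 Remark 1.1 and VIII.8] -/
theorem isGloballyMinimal_of_int_criterion_kraus_two (a1 a2 a3 a4 a6 : ℤ) {x y : ℤ}
    (hx : c4Of [a1, a2, a3, a4, a6] = 16 * x) (hy : c6Of [a1, a2, a3, a4, a6] = 64 * y)
    (hk : ¬ (((16 : ℤ) ∣ x ∧ ((32 : ℤ) ∣ y ∨ (32 : ℤ) ∣ y - 8)) ∨ (4 : ℤ) ∣ y + 1))
    (h : ∀ q : ℕ, q.Prime → q ≠ 2 → ¬ (q : ℤ) ^ 12 ∣ discOf [a1, a2, a3, a4, a6]) :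
    (⟨a1, a2, a3, a4, a6⟩ : WeierstrassCurve ℚ).IsGloballyMinimal where
  isIntegral := isIntegral_of_exists_lift (𝓞 ℚ) ⟨(a1 : 𝓞 ℚ), by simp⟩ ⟨(a2 : 𝓞 ℚ), by simp⟩
    ⟨(a3 : 𝓞 ℚ), by simp⟩ ⟨(a4 : 𝓞 ℚ), by simp⟩ ⟨(a6 : 𝓞 ℚ), by simp⟩
  isMinimal v := by
    set W : WeierstrassCurve ℚ := ⟨a1, a2, a3, a4, a6⟩ with hW
    have hle : ∀ m : ℤ, v.valuation ℚ (m : ℚ) ≤ 1 := fun m ↦ by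
      have hm : (m : ℚ) = algebraMap (𝓞 ℚ) ℚ (m : 𝓞 ℚ) := by simp
      rw [hm]
      exact v.valuation_le_one _
    have hint : W.IsIntegralAt v :=
      W.isIntegralAt_of_valuation_le_one v (hle a1) (hle a2) (hle a3) (hle a4) (hle a6)
    have hΔ : W.Δ = ((discOf [a1, a2, a3, a4, a6] : ℤ) : ℚ) := by
      simp only [hW, WeierstrassCurve.Δ, WeierstrassCurve.b₂, WeierstrassCurve.b₄, WeierstrassCurve.b₆,
        WeierstrassCurve.b₈, discOf, invariants]
      push_cast
      ring
    have hc4 : W.c₄ = ((c4Of [a1, a2, a3, a4, a6] : ℤ) : ℚ) := by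
      simp only [hW, WeierstrassCurve.c₄, WeierstrassCurve.b₂, WeierstrassCurve.b₄, c4Of, invariants]
      push_cast
      ring
    have hc6 : W.c₆ = ((c6Of [a1, a2, a3, a4, a6] : ℤ) : ℚ) := by
      simp only [hW, WeierstrassCurve.c₆, WeierstrassCurve.b₂, WeierstrassCurve.b₄, WeierstrassCurve.b₆,
        c6Of, invariants]
      push_cast
      ring
    by_cases hv2 : natGenerator v = 2
    · exact isMinimalAt_two_of_kraus_violated v W hv2 hint (x := x) (y := y)
        (by rw [hc4, hx]; push_cast; ring) (by rw [hc6, hy]; push_cast; ring) hk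
    · exact isMinimalAt_of_lt_valuation_Δ_holds hint
        (by rw [hΔ]; exact exp_neg_lt_valuation_intCast_of_not_pow_dvd v (h _ (prime_natGenerator v) hv2))

/-! ## §3 The twists `37a1^{(D)}`, `D ≡ 3 (mod 4)` square-free: the global minimal model
`V_D : y² = x³ − 16D² x + 16D³` -/

/-- The tree's quadratic twist of `37a1` by `D` is the (non-integral at `2`) model `y² = x³ − D²x + D³/4`
(`b₂ = 0`, `b₄ = −2`, `b₆ = 1`). [cite: SilvermanAEC2009, X.2 (remark after Prop. 2.4)] -/
theorem twist_37a1_eq (D : ℚ) :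
    (⟨0, 0, 1, -1, 0⟩ : WeierstrassCurve ℚ).quadraticTwist D = ⟨0, 0, 0, -D ^ 2, D ^ 3 / 4⟩ := by
  ext
  · simp [quadraticTwist]
  · simp [quadraticTwist, WeierstrassCurve.b₂]
  · simp [quadraticTwist]
  · simp [quadraticTwist, WeierstrassCurve.b₄]; ring
  · simp [quadraticTwist, WeierstrassCurve.b₆]

/-- The scaling `u = 1/2` (`a₄ ↦ 16a₄`, `a₆ ↦ 64a₆`) carries the raw twist to the integer model
`V_D : y² = x³ − 16D²x + 16D³`. [cite: SilvermanAEC2009, III.1 Table 3.1] -/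
theorem half_smul_twist_37a1_eq (D : ℚ) :
    (⟨Units.mk0 (1 / 2 : ℚ) (by norm_num), 0, 0, 0⟩ : VariableChange ℚ) •
        (⟨0, 0, 1, -1, 0⟩ : WeierstrassCurve ℚ).quadraticTwist D =
      ⟨0, 0, 0, -16 * D ^ 2, 16 * D ^ 3⟩ := by
  rw [twist_37a1_eq]
  ext
  · simp [variableChange_a₁]
  · simp [variableChange_a₂]
  · simp [variableChange_a₃]
  · simp [variableChange_a₄]; norm_num
  · simp [variableChange_a₆]; ring

/-- The certificate-schema discriminant `discOf [0,0,0,−16D²,16D³] = 151552·D⁶ = 2¹²·37·D⁶`. [cite: SilvermanAEC2009, III.1] -/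
theorem discOf_twist37 (D : ℤ) : discOf [0, 0, 0, -16 * D ^ 2, 16 * D ^ 3] = 151552 * D ^ 6 := by
  simp only [discOf, invariants]; ring

/-- `Δ(V_D) = 151552·D⁶` over `ℤ`. [cite: SilvermanAEC2009, III.1] -/
theorem intΔ_twist37 (D : ℤ) : (⟨0, 0, 0, -16 * D ^ 2, 16 * D ^ 3⟩ : WeierstrassCurve ℤ).Δ = 151552 * D ^ 6 := by
  simp only [WeierstrassCurve.Δ, WeierstrassCurve.b₂, WeierstrassCurve.b₄, WeierstrassCurve.b₆, WeierstrassCurve.b₈]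
  ring

/-- `c₄(V_D) = 768·D² = 2⁸·3·D²` over `ℤ`. [cite: SilvermanAEC2009, III.1] -/
theorem intc₄_twist37 (D : ℤ) : (⟨0, 0, 0, -16 * D ^ 2, 16 * D ^ 3⟩ : WeierstrassCurve ℤ).c₄ = 768 * D ^ 2 := by
  simp only [WeierstrassCurve.c₄, WeierstrassCurve.b₂, WeierstrassCurve.b₄]
  ring

/-- `Δ(V_D) = 151552·D⁶` over `ℚ`. [cite: SilvermanAEC2009, III.1] -/
theorem Δ_twist37 (D : ℚ) : (⟨0, 0, 0, -16 * D ^ 2, 16 * D ^ 3⟩ : WeierstrassCurve ℚ).Δ = 151552 * D ^ 6 := by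
  simp only [WeierstrassCurve.Δ, WeierstrassCurve.b₂, WeierstrassCurve.b₄, WeierstrassCurve.b₆, WeierstrassCurve.b₈]
  ring

/-- `V_D` is an elliptic curve for `D ≠ 0`. [cite: SilvermanAEC2009, III.1] -/
theorem isElliptic_twist37 {D : ℚ} (hD : D ≠ 0) :
    (⟨0, 0, 0, -16 * D ^ 2, 16 * D ^ 3⟩ : WeierstrassCurve ℚ).IsElliptic :=
  ⟨isUnit_iff_ne_zero.mpr (by rw [Δ_twist37]; exact mul_ne_zero (by norm_num) (pow_ne_zero 6 hD))⟩

/-- For `m` square-free and `q` an ODD prime, `v_q(151552·m⁶) ≤ 7 < 12` (`151552 = 2¹²·37`). [folklore] -/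
theorem padicValNat_151552_mul_pow_lt (m : ℕ) (hm : m ≠ 0)
    (hsq : ∀ q : ℕ, q.Prime → ¬ q ^ 2 ∣ m) {q : ℕ} (hq : q.Prime) (hq2 : q ≠ 2) :
    padicValNat q (151552 * m ^ 6) < 12 := by
  haveI : Fact q.Prime := ⟨hq⟩
  have hvM : padicValNat q m ≤ 1 := by
    by_contra hle
    exact hsq q hq ((padicValNat_dvd_iff_le hm).mpr (by omega))
  have h37 : padicValNat q 37 ≤ 1 := by
    by_cases h : q = 37
    · subst h; rw [padicValNat_self]
    · rw [padicValNat.eq_zero_of_not_dvd (fun hd => h ((Nat.prime_dvd_prime_iff_eq hq (by norm_num)).mp hd))]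
      exact zero_le_one
  rw [padicValNat.mul (by norm_num) (pow_ne_zero 6 hm), padicValNat.pow m 6,
    show (151552 : ℕ) = 2 ^ 12 * 37 by norm_num, padicValNat.mul (by norm_num) (by norm_num),
    padicValNat.eq_zero_of_not_dvd
      (fun hd => hq2 ((Nat.prime_dvd_prime_iff_eq hq Nat.prime_two).mp (hq.dvd_of_dvd_pow hd)))]
  omega

/-- **`V_D : y² = x³ − 16D²x + 16D³` is a GLOBAL MINIMAL MODEL of `37a1^{(D)}` for `D ≡ 3 (mod 4)` square-free**:
`Δ = 2¹²·37·D⁶`, `c₄ = 16·(48D²)`, `c₆ = 64·(−216D³)`; at `2` Kraus's test is violated because `D³ ≡ 3 (mod 4)`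
(`32 ∤ −216D³`, `32 ∤ −216D³ − 8`, `4 ∤ −216D³ + 1`), so the model is minimal at `2` with `v₂(Δ) = 12`; at odd `q`,
`v_q(Δ) ≤ 7`. [cite: Kraus1989, Prop. 2] [cite: SilvermanAEC2009, VII.1 Remark 1.1] -/
theorem isGloballyMinimal_twist37 (D : ℤ) (hD4 : D % 4 = 3)
    (hsq : ∀ q : ℕ, q.Prime → ¬ q ^ 2 ∣ D.natAbs) :
    (⟨0, 0, 0, -16 * (D : ℚ) ^ 2, 16 * (D : ℚ) ^ 3⟩ : WeierstrassCurve ℚ).IsGloballyMinimal := by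
  have hD0 : D ≠ 0 := by rintro rfl; simp at hD4
  have hm0 : D.natAbs ≠ 0 := Int.natAbs_ne_zero.mpr hD0
  have hK : D ^ 3 % 4 = 3 := by
    have h3 : D ≡ 3 [ZMOD 4] := hD4
    have := h3.pow 3
    exact this
  have key := isGloballyMinimal_of_int_criterion_kraus_two 0 0 0 (-16 * D ^ 2) (16 * D ^ 3)
    (x := 48 * D ^ 2) (y := -216 * D ^ 3)
    (by simp only [c4Of, invariants]; ring) (by simp only [c6Of, invariants]; ring)
    (by
      generalize hJ : D ^ 2 = J at *
      generalize hK' : D ^ 3 = K at *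
      omega)
    (fun q hq hq2 hdvd => by
      rw [discOf_twist37] at hdvd
      have hd' : q ^ 12 ∣ 151552 * D.natAbs ^ 6 := by
        have := Int.natAbs_dvd_natAbs.mpr hdvd
        simpa [Int.natAbs_mul, Int.natAbs_pow] using this
      have hne : 151552 * D.natAbs ^ 6 ≠ 0 := mul_ne_zero (by norm_num) (pow_ne_zero 6 hm0)
      haveI : Fact q.Prime := ⟨hq⟩
      have := (padicValNat_dvd_iff_le hne).mp hd'
      have hlt := padicValNat_151552_mul_pow_lt D.natAbs hm0 hsq hq hq2
      omega)
  have hcast : (⟨((0 : ℤ) : ℚ), ((0 : ℤ) : ℚ), ((0 : ℤ) : ℚ), ((-16 * D ^ 2 : ℤ) : ℚ),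
      ((16 * D ^ 3 : ℤ) : ℚ)⟩ : WeierstrassCurve ℚ) = ⟨0, 0, 0, -16 * (D : ℚ) ^ 2, 16 * (D : ℚ) ^ 3⟩ := by
    ext <;> push_cast <;> ring
  rw [hcast] at key
  exact key


/-! ## §5 The habitat of C3″ at every model of `37a1^{(D)}` -/

/-- **`V_D` is ADDITIVE at `2`** (`2 ∣ Δ`, `2 ∣ c₄` on the global minimal model; `Additive.addv_of_intModel`).
[cite: SilvermanAEC2009, VII.5 Prop. 5.1(c)] -/
theorem addv_two_twist37_model (D : ℤ) (hD4 : D % 4 = 3) (hsq : ∀ q : ℕ, q.Prime → ¬ q ^ 2 ∣ D.natAbs) :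
    Addv (⟨0, 0, 0, -16 * (D : ℚ) ^ 2, 16 * (D : ℚ) ^ 3⟩ : WeierstrassCurve ℚ) 2 := by
  have hD0 : (D : ℚ) ≠ 0 := by
    have : D ≠ 0 := by rintro rfl; simp at hD4
    exact_mod_cast this
  haveI := isElliptic_twist37 hD0
  haveI := isGloballyMinimal_twist37 D hD4 hsq
  have hI : integralModelInt (⟨0, 0, 0, -16 * (D : ℚ) ^ 2, 16 * (D : ℚ) ^ 3⟩ : WeierstrassCurve ℚ) =
      ⟨0, 0, 0, -16 * D ^ 2, 16 * D ^ 3⟩ :=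
    integralModelInt_eq_of_map_eq _ (by ext <;> simp [WeierstrassCurve.map])
  refine Additive.addv_of_intModel hI 2 ?_ ?_
  · rw [intΔ_twist37]; exact ⟨75776 * D ^ 6, by ring⟩
  · rw [intc₄_twist37]; exact ⟨384 * D ^ 2, by ring⟩

/-- Every model `C • 37a1^{(D)}` (`D ≠ 0`) has `j = 110592/37` (`variableChange_j`, `j_quadraticTwist`).
[cite: SilvermanAEC2009, III.1 Prop. 1.4(b) and X.5 Cor. 5.4(iii)] -/
theorem j_smul_twist37 [(⟨0, 0, 1, -1, 0⟩ : WeierstrassCurve ℚ).IsElliptic] {D : ℚ} (hD : D ≠ 0)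
    (C : VariableChange ℚ) [hE : (C • (⟨0, 0, 1, -1, 0⟩ : WeierstrassCurve ℚ).quadraticTwist D).IsElliptic] :
    (C • (⟨0, 0, 1, -1, 0⟩ : WeierstrassCurve ℚ).quadraticTwist D).j = 110592 / 37 := by
  haveI : ((⟨0, 0, 1, -1, 0⟩ : WeierstrassCurve ℚ).quadraticTwist D).IsElliptic :=
    isElliptic_quadraticTwist _ hD
  rw [variableChange_j, j_quadraticTwist _ hD, j_37a1]

/-- The raw twist `37a1^{(D)}` (`D ≡ 3 (mod 4)` square-free) is ADDITIVE at `2` (transported from `V_D` along `u = 1/2`;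
reduction types are isomorphism invariants). [cite: SilvermanAEC2009, VII.5 Prop. 5.1] -/
theorem addv_two_twist37_raw [(⟨0, 0, 1, -1, 0⟩ : WeierstrassCurve ℚ).IsElliptic] (D : ℤ) (hD4 : D % 4 = 3)
    (hsq : ∀ q : ℕ, q.Prime → ¬ q ^ 2 ∣ D.natAbs) :
    Addv ((⟨0, 0, 1, -1, 0⟩ : WeierstrassCurve ℚ).quadraticTwist (D : ℚ)) 2 := by
  have hD0 : (D : ℚ) ≠ 0 := by
    have : D ≠ 0 := by rintro rfl; simp at hD4
    exact_mod_cast this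
  haveI := isElliptic_twist37 hD0
  haveI : ((⟨0, 0, 1, -1, 0⟩ : WeierstrassCurve ℚ).quadraticTwist (D : ℚ)).IsElliptic :=
    isElliptic_quadraticTwist _ hD0
  have hV := half_smul_twist_37a1_eq (D : ℚ)
  have haddV : Addv ((⟨Units.mk0 (1 / 2 : ℚ) (by norm_num), 0, 0, 0⟩ : VariableChange ℚ) •
      (⟨0, 0, 1, -1, 0⟩ : WeierstrassCurve ℚ).quadraticTwist (D : ℚ)) 2 := by
    rw [hV]; exact addv_two_twist37_model D hD4 hsq
  exact ⟨fun h => haddV.1 ((hasGoodReductionAtPrime_iff_of_variableChange _ _ 2).mpr h),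
    fun h => haddV.2 ((Literature.NumberTheory.EllipticCurves.hasMultiplicativeReductionAtPrime_smul_iff _ _ 2).mpr h)⟩

/-- **The habitat of C3″ at every model `C • 37a1^{(D)}`**, `D ≡ 3 (mod 4)` square-free: ADDITIVE at `2`, POTENTIALLY
GOOD (`j = 2¹²·27/37`, `ord₂ j = 12 ≥ 0`), NON-CM (`ord₃₇ j = −1`), and `E[2]` IRREDUCIBLE (from `37a1` by the tree's
`P2.irr_two_iff_of_twist`). [cite: SilvermanAEC2009, VII.5 Prop. 5.1, III.1 Prop. 1.4(b), App. C §11] -/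
theorem habitat_smul_twist37 [(⟨0, 0, 1, -1, 0⟩ : WeierstrassCurve ℚ).IsElliptic]
    [(⟨0, 0, 1, -1, 0⟩ : WeierstrassCurve ℚ).IsGloballyMinimal] (D : ℤ) (hD4 : D % 4 = 3)
    (hsq : ∀ q : ℕ, q.Prime → ¬ q ^ 2 ∣ D.natAbs) (C : VariableChange ℚ)
    [hE : (C • (⟨0, 0, 1, -1, 0⟩ : WeierstrassCurve ℚ).quadraticTwist (D : ℚ)).IsElliptic] :
    Addv (C • (⟨0, 0, 1, -1, 0⟩ : WeierstrassCurve ℚ).quadraticTwist (D : ℚ)) 2 ∧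
      0 ≤ padicValRat 2 (C • (⟨0, 0, 1, -1, 0⟩ : WeierstrassCurve ℚ).quadraticTwist (D : ℚ)).j ∧
      ¬ (C • (⟨0, 0, 1, -1, 0⟩ : WeierstrassCurve ℚ).quadraticTwist (D : ℚ)).HasCM ∧
      Irr (C • (⟨0, 0, 1, -1, 0⟩ : WeierstrassCurve ℚ).quadraticTwist (D : ℚ)) 2 := by
  haveI : Fact (Nat.Prime 2) := ⟨Nat.prime_two⟩
  have hD0 : (D : ℚ) ≠ 0 := by
    have : D ≠ 0 := by rintro rfl; simp at hD4
    exact_mod_cast this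
  haveI hX : ((⟨0, 0, 1, -1, 0⟩ : WeierstrassCurve ℚ).quadraticTwist (D : ℚ)).IsElliptic :=
    isElliptic_quadraticTwist _ hD0
  have hj := j_smul_twist37 hD0 C
  have haddT := addv_two_twist37_raw D hD4 hsq
  refine ⟨⟨fun h => haddT.1 ((hasGoodReductionAtPrime_iff_of_variableChange _ C 2).mp h),
    fun h => haddT.2 ((Literature.NumberTheory.EllipticCurves.hasMultiplicativeReductionAtPrime_smul_iff _ C 2).mp h)⟩,
    ?_, ?_, ?_⟩
  · rw [hj, padicValRat_two_j37]; norm_num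
  · exact not_hasCM_of_padicValRat_j_neg (p := 37) (by rw [hj, padicValRat_37_j37]; norm_num)
  · exact (irr_two_iff_of_twist _ hD0 ⟨C, rfl⟩).mp irr_two_37a1

end Summit.BirchSwinnertonDyer.BirchSwinnertonDyer.Theorems.AddPotGoodPrint

end
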